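import Literature.AlgebraicGeometry.Resolution.CobordantBlowupFiltration
import Literature.AlgebraicGeometry.Resolution.RsopLocalization
import Literature.AlgebraicGeometry.Resolution.SmoothUniformizationProofs
import Mathlib.RingTheory.RegularLocalRing.Defs
import Mathlib.RingTheory.Smooth.Locus
import Mathlib.RingTheory.Polynomial.Quotient
import Mathlib.Algebra.Polynomial.Laurent
import HarnessLib

/-!
# Rung `e = 1` of the door: the trivial end `B₋ = Y × 𝔾ₘ` of the cobordant blow-up (ring level)

Route `ResolutionOfSingularities/WeightedInvariant`, door crux `HypersurfaceCentreConstruction`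
(stmt-ResolutionOfSingularities-19897), e-ladder line of `res-L1-w43-stub-10`; helper toward the stub
`stub_e1_inv_succ` («the successor stage satisfies the invariant»), sub-goal (M5) «singular points of the strict
transform lie over the support of the centre».  RING LEVEL of that statement (Włodarczyk, arXiv:2203.03090,
Def. 2.3.5: `B₋ = B ∖ V(t⁻¹) = X × 𝔾ₘ` is the trivial end of the cobordism): for the extended Rees algebra
`S = A[t⁻¹, Jₙ tⁿ] ⊆ A[t, t⁻¹]` of an ideal filtration on `A`, at a prime `Q` of `S` NOT containing `t⁻¹`,

* `S_Q` is a localization of the POLYNOMIAL ring `A[X]` (`X ↦ t⁻¹`) at the prime `Q ∩ A[X]`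
  (`isLocalization_atPrime_comap_aeval`; every element of `S` becomes a polynomial in `t⁻¹` after
  multiplication by a power of `t⁻¹`, `exists_pow_mul_eq_aeval`);
* the `t⁻¹`-saturation `σ = ⋃ₙ (𝔞S : t⁻ⁿ)` of an extended ideal (the strict transform, ibid. 3.3.12) agrees with
  `𝔞S` after localization at `Q` (`map_iSup_colon_eq_map`);
* regularity of `A_p/𝔞A_p` (`p = Q ∩ A`) implies regularity of `S_Q/σS_Q`
  (`isRegularLocalRing_localization_quotient_saturation`), through EGA IV 17.5.8 for the smooth algebra
  `(A/𝔞)[X]` (`Grothendieck1967_17_5_8_holds`) and `R_q/IR_q = (R/I)_{q/I}`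
  (`isLocalization_atPrime_quotient_map_of_le`) — the polynomial core is
  `isRegularLocalRing_localization_polynomial_quotient`.

Nothing here is a claim about Hironaka's problem; AI-written, weaker than expert review.
-/

noncomputable section

set_option linter.dupNamespace false -- mandated namespace of this single-conjunct summit

open scoped LaurentPolynomial Polynomial
open LaurentPolynomial Polynomial IsLocalRing
open Literature.AlgebraicGeometry.Resolution

namespace Summit.ResolutionOfSingularities.ResolutionOfSingularities.Theorems.ELadderOne.TrivialEnd

universe u

/-! ## Transport between localizations at equal primes -/

/-- Regularity of the localization at a prime only depends on the prime (the types
`Localization.AtPrime I`, `Localization.AtPrime J` differ for `I = J` not definitional). [folklore] -/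
theorem isRegularLocalRing_atPrime_of_eq {R : Type*} [CommRing R] {I J : Ideal R} [I.IsPrime]
    [J.IsPrime] (h : I = J) (hI : IsRegularLocalRing (Localization.AtPrime I)) :
    IsRegularLocalRing (Localization.AtPrime J) := by
  subst h
  exact hI

/-- The same transport for the quotients `R_I/𝔞R_I`. [folklore] -/
theorem isRegularLocalRing_atPrime_quotient_of_eq {R : Type*} [CommRing R] (𝔞 : Ideal R)
    {I J : Ideal R} [I.IsPrime] [J.IsPrime] (h : I = J)
    (hI : IsRegularLocalRing (Localization.AtPrime I ⧸ 𝔞.map (algebraMap R (Localization.AtPrime I)))) :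
    IsRegularLocalRing (Localization.AtPrime J ⧸ 𝔞.map (algebraMap R (Localization.AtPrime J))) := by
  subst h
  exact hI

/-! ## The polynomial core: `A_p/𝔞A_p` regular ⇒ `A[X]_𝔔/𝔞A[X]_𝔔` regular -/

/-- **Regularity ascends from `A_p/𝔞A_p` to `A[X]_𝔔/𝔞 A[X]_𝔔`** (`𝔔 ∩ A = p ⊇ 𝔞`, `A` Noetherian):
`A[X]_𝔔/𝔞A[X]_𝔔` is the localization of the smooth `(A/𝔞)`-algebra `(A/𝔞)[X]` at the prime `𝔔/𝔞`, whose
regularity is that of `(A/𝔞)_{p/𝔞} = A_p/𝔞A_p` by EGA IV₄ 17.5.8 (iii). [cite: Grothendieck1967, Prop. 17.5.8 (iii)] -/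
theorem isRegularLocalRing_localization_polynomial_quotient {A : Type u} [CommRing A] [IsNoetherianRing A]
    (𝔞 : Ideal A) (𝔔 : Ideal A[X]) [𝔔.IsPrime] (h𝔞 : 𝔞.map (Polynomial.C : A →+* A[X]) ≤ 𝔔)
    (hreg : IsRegularLocalRing
      (Localization.AtPrime (𝔔.comap (Polynomial.C : A →+* A[X])) ⧸
        𝔞.map (algebraMap A (Localization.AtPrime (𝔔.comap (Polynomial.C : A →+* A[X])))))) :
    IsRegularLocalRing (Localization.AtPrime 𝔔 ⧸
      (𝔞.map (Polynomial.C : A →+* A[X])).map (algebraMap A[X] (Localization.AtPrime 𝔔))) := by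
  set p : Ideal A := 𝔔.comap (Polynomial.C : A →+* A[X]) with hp
  have h𝔞p : 𝔞 ≤ p := fun a ha => Ideal.mem_comap.mpr (h𝔞 (Ideal.mem_map_of_mem _ ha))
  set π : A →+* A ⧸ 𝔞 := Ideal.Quotient.mk 𝔞 with hπ
  have hkerπ : RingHom.ker π = 𝔞 := Ideal.mk_ker
  haveI hp' : (p.map π).IsPrime :=
    Ideal.map_isPrime_of_surjective Ideal.Quotient.mk_surjective (by rw [hkerπ]; exact h𝔞p)
  have hmemp : ∀ a : A, π a ∈ p.map π ↔ a ∈ p := by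
    intro a
    rw [← Ideal.mem_comap, Ideal.comap_map_of_surjective _ Ideal.Quotient.mk_surjective,
      ← RingHom.ker_eq_comap_bot, hkerπ, sup_eq_left.mpr h𝔞p]
  -- K1: `(A/𝔞)_{p/𝔞} = A_p/𝔞A_p` is regular
  have K1 : IsRegularLocalRing (Localization.AtPrime (p.map π)) := by
    haveI := isLocalization_atPrime_quotient_map_of_le 𝔞 p h𝔞p (Localization.AtPrime p)
    haveI := hreg
    exact IsRegularLocalRing.of_ringEquiv
      (IsLocalization.algEquiv (p.map π).primeCompl
        (Localization.AtPrime p ⧸ 𝔞.map (algebraMap A (Localization.AtPrime p)))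
        (Localization.AtPrime (p.map π))).toRingEquiv
  -- the prime `𝔔/𝔞` of `(A/𝔞)[X]`
  set πX : A[X] →+* (A ⧸ 𝔞)[X] := Polynomial.mapRingHom π with hπX
  have hπXs : Function.Surjective πX := Polynomial.map_surjective π Ideal.Quotient.mk_surjective
  have hkerπX : RingHom.ker πX = 𝔞.map (Polynomial.C : A →+* A[X]) := by
    rw [hπX, Polynomial.ker_mapRingHom, hkerπ]
  set 𝔔B : Ideal (A ⧸ 𝔞)[X] := 𝔔.map πX with h𝔔B
  haveI h𝔔B' : 𝔔B.IsPrime := Ideal.map_isPrime_of_surjective hπXs (by rw [hkerπX]; exact h𝔞)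
  have hcomap𝔔B : 𝔔B.comap πX = 𝔔 := by
    rw [h𝔔B, Ideal.comap_map_of_surjective _ hπXs, ← RingHom.ker_eq_comap_bot, hkerπX,
      sup_eq_left.mpr h𝔞]
  have hmem𝔔 : ∀ f : A[X], πX f ∈ 𝔔B ↔ f ∈ 𝔔 := fun f => by rw [← Ideal.mem_comap, hcomap𝔔B]
  have h𝔔Bp : p.map π = 𝔔B.comap (algebraMap (A ⧸ 𝔞) (A ⧸ 𝔞)[X]) := by
    ext b
    obtain ⟨a, rfl⟩ := Ideal.Quotient.mk_surjective b
    rw [hmemp, hp, Ideal.mem_comap, Ideal.mem_comap, Polynomial.algebraMap_eq,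
      show Polynomial.C (Ideal.Quotient.mk 𝔞 a) = πX (Polynomial.C a) by
        rw [hπX, Polynomial.coe_mapRingHom, Polynomial.map_C], hmem𝔔]
  -- K3: EGA IV 17.5.8 for the smooth algebra `(A/𝔞)[X]`
  have K3 : IsRegularLocalRing (Localization.AtPrime 𝔔B) := by
    have hsm : Algebra.IsSmoothAt (A ⧸ 𝔞) 𝔔B := by
      dsimp only [Algebra.IsSmoothAt]
      infer_instance
    rw [Grothendieck1967_17_5_8_holds (A ⧸ 𝔞) (A ⧸ 𝔞)[X] inferInstance 𝔔B hsm]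
    exact isRegularLocalRing_atPrime_of_eq h𝔔Bp K1
  -- K4: `A[X]_𝔔/𝔞A[X]_𝔔 = (A[X]/𝔞A[X])_{𝔔/𝔞} ≅ ((A/𝔞)[X])_{𝔔B}`
  set I : Ideal A[X] := 𝔞.map (Polynomial.C : A →+* A[X]) with hI
  haveI hI' : (𝔔.map (Ideal.Quotient.mk I)).IsPrime :=
    Ideal.map_isPrime_of_surjective Ideal.Quotient.mk_surjective (by rw [Ideal.mk_ker]; exact h𝔞)
  haveI := isLocalization_atPrime_quotient_map_of_le I 𝔔 h𝔞 (Localization.AtPrime 𝔔)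
  have hmemI : ∀ f : A[X], Ideal.Quotient.mk I f ∈ 𝔔.map (Ideal.Quotient.mk I) ↔ f ∈ 𝔔 := by
    intro f
    rw [← Ideal.mem_comap, Ideal.comap_map_of_surjective _ Ideal.Quotient.mk_surjective,
      ← RingHom.ker_eq_comap_bot, Ideal.mk_ker, sup_eq_left.mpr h𝔞]
  let e₀ : (A ⧸ 𝔞)[X] ≃+* A[X] ⧸ I := Ideal.polynomialQuotientEquivQuotientPolynomial 𝔞
  have He₀ : 𝔔B.primeCompl.map e₀.toMonoidHom = (𝔔.map (Ideal.Quotient.mk I)).primeCompl := by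
    ext x
    constructor
    · rintro ⟨g, hg, rfl⟩
      obtain ⟨f, rfl⟩ := hπXs g
      change e₀ (Polynomial.map (Ideal.Quotient.mk 𝔞) f) ∉ 𝔔.map (Ideal.Quotient.mk I)
      rw [Ideal.polynomialQuotientEquivQuotientPolynomial_map_mk, hmemI]
      exact fun hf => hg ((hmem𝔔 f).mpr hf)
    · intro hx
      obtain ⟨f, rfl⟩ := Ideal.Quotient.mk_surjective x
      refine ⟨πX f, fun hf => hx ((hmemI f).mpr ((hmem𝔔 f).mp hf)), ?_⟩
      change e₀ (Polynomial.map (Ideal.Quotient.mk 𝔞) f) = _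
      rw [Ideal.polynomialQuotientEquivQuotientPolynomial_map_mk]
  let e : Localization.AtPrime 𝔔B ≃+*
      Localization.AtPrime 𝔔 ⧸ I.map (algebraMap A[X] (Localization.AtPrime 𝔔)) :=
    IsLocalization.ringEquivOfRingEquiv (M := 𝔔B.primeCompl) (T := (𝔔.map (Ideal.Quotient.mk I)).primeCompl)
      (Localization.AtPrime 𝔔B) (Localization.AtPrime 𝔔 ⧸ I.map (algebraMap A[X] (Localization.AtPrime 𝔔)))
      e₀ He₀
  exact @IsRegularLocalRing.of_ringEquiv (Localization.AtPrime 𝔔B) _ K3 _ _ e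

/-! ## The extended Rees algebra away from `t⁻¹`: a localization of `A[X]` -/

section ExtendedRees

variable {A : Type u} [CommRing A] (F : IdealFiltration A)
  (t : F.extendedRees) (ht : (t : A[T;T⁻¹]) = T (-1))

include ht in
/-- The substitution `X ↦ t⁻¹` into the extended Rees algebra is, inside `A[t, t⁻¹]`, the polynomial map
`A[X] → A[t, t⁻¹]` followed by `t ↦ t⁻¹`. [folklore] -/
theorem coe_aeval_eq (f : A[X]) :
    ((aeval t f : F.extendedRees) : A[T;T⁻¹]) = invert (toLaurent f) := by
  have h1 : (F.extendedRees.val).comp (aeval t) =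
      ((invert (R := A)).toAlgHom).comp (toLaurentAlg (R := A)) := by
    apply Polynomial.algHom_ext
    change ((aeval t (X : A[X]) : F.extendedRees) : A[T;T⁻¹]) = invert (toLaurent (X : A[X]))
    rw [aeval_X, ht, toLaurent_X, invert_T]
  exact congr($h1 f)

include ht in
/-- `X ↦ t⁻¹` is injective on `A[X]`. [folklore] -/
theorem aeval_injective : Function.Injective (aeval t : A[X] → F.extendedRees) := by
  intro f g hfg
  have h := congrArg (fun s : F.extendedRees => (s : A[T;T⁻¹])) hfg
  simp only [coe_aeval_eq F t ht] at h
  exact toLaurent_injective ((invert (R := A)).injective h)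

include ht in
/-- **Every element of `A[t⁻¹, Jₙ tⁿ]` is a polynomial in `t⁻¹` after multiplication by a power of `t⁻¹`.**
[folklore] -/
theorem exists_pow_mul_eq_aeval (s : F.extendedRees) : ∃ (n : ℕ) (f : A[X]), t ^ n * s = aeval t f := by
  obtain ⟨n, f, hf⟩ := exists_T_pow (invert (s : A[T;T⁻¹]))
  refine ⟨n, f, Subtype.ext ?_⟩
  have h2 : invert (toLaurent f) = (s : A[T;T⁻¹]) * T (-(n : ℤ)) := by
    rw [hf, map_mul, invert_T, involutive_invert]
  rw [Subalgebra.coe_mul, SubmonoidClass.coe_pow, ht, coe_aeval_eq F t ht, h2, T_pow, mul_comm]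
  congr 2
  ring

/-- In a localization of the extended Rees algebra at a prime not containing `t⁻¹`, the `t⁻¹`-saturation
`⋃ₙ (J : t⁻ⁿ)` of an ideal `J` extends to the same ideal as `J`. [folklore] -/
theorem map_iSup_colon_eq_map (J : Ideal F.extendedRees) (Q : Ideal F.extendedRees) [Q.IsPrime] (htQ : t ∉ Q)
    (Sq : Type*) [CommRing Sq] [Algebra F.extendedRees Sq] [IsLocalization.AtPrime Sq Q] :
    Ideal.map (algebraMap F.extendedRees Sq)
        (⨆ n : ℕ, J.colon ((Ideal.span {t} ^ n : Ideal F.extendedRees) : Set F.extendedRees)) =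
      J.map (algebraMap F.extendedRees Sq) := by
  have hmem : ∀ (n : ℕ) (y : F.extendedRees),
      y ∈ J.colon ((Ideal.span {t} ^ n : Ideal F.extendedRees) : Set F.extendedRees) ↔ t ^ n * y ∈ J := by
    intro n y
    rw [Ideal.span_singleton_pow]
    change y ∈ Submodule.colon J ((Submodule.span F.extendedRees {t ^ n} :
      Submodule F.extendedRees F.extendedRees) : Set F.extendedRees) ↔ _
    rw [Submodule.colon_span, Submodule.mem_colon_singleton, smul_eq_mul, mul_comm]
  apply le_antisymm
  · rw [Ideal.map_iSup]
    refine iSup_le fun n => ?_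
    rw [Ideal.map_le_iff_le_comap]
    intro x hx
    rw [hmem] at hx
    rw [Ideal.mem_comap]
    have hu : IsUnit (algebraMap F.extendedRees Sq (t ^ n)) := by
      rw [map_pow]
      exact (IsLocalization.map_units Sq (⟨t, htQ⟩ : Q.primeCompl)).pow n
    have h := Ideal.mem_map_of_mem (algebraMap F.extendedRees Sq) hx
    rw [map_mul] at h
    exact (Ideal.unit_mul_mem_iff_mem _ hu).mp h
  · refine Ideal.map_mono fun x hx => ?_
    refine (Submodule.mem_iSup_of_mem 0 ?_)
    rw [hmem, pow_zero, one_mul]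
    exact hx

include ht in
/-- **The trivial end of the cobordism, ring level.**  Let `S = A[t⁻¹, Jₙ tⁿ]` be the extended Rees algebra
of an ideal filtration on a Noetherian ring `A`, `Q` a prime of `S` not containing `t⁻¹`, `S_Q` a localization
of `S` at `Q`, `p = Q ∩ A`, and `𝔞` an ideal of `A` with `𝔞S ⊆ Q`.  If `A_p/𝔞A_p` is a regular local ring, then
so is `S_Q/σS_Q`, `σ = ⋃ₙ (𝔞S : t⁻ⁿ)` the strict transform of `𝔞` (Włodarczyk 3.3.12): `S_Q` is the localization
of `A[X]` (`X ↦ t⁻¹`) at `Q ∩ A[X]`, `σS_Q = 𝔞S_Q`, and `A[X]_𝔔/𝔞` is regular over the regular `A_p/𝔞`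
(`B₋ = V(𝔞) × 𝔾ₘ → V(𝔞)` is smooth). [cite: Wlodarczyk2022, Def. 2.3.5 and 3.3.12] -/
theorem isRegularLocalRing_localization_quotient_saturation [IsNoetherianRing A] (𝔞 : Ideal A)
    (Q : Ideal F.extendedRees) [Q.IsPrime] (htQ : t ∉ Q)
    (h𝔞Q : 𝔞.map (algebraMap A F.extendedRees) ≤ Q)
    {p : Ideal A} [p.IsPrime] (hp : Q.comap (algebraMap A F.extendedRees) = p)
    (hreg : IsRegularLocalRing (Localization.AtPrime p ⧸ 𝔞.map (algebraMap A (Localization.AtPrime p))))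
    (Sq : Type u) [CommRing Sq] [Algebra F.extendedRees Sq] [IsLocalization.AtPrime Sq Q] :
    IsRegularLocalRing (Sq ⧸ Ideal.map (algebraMap F.extendedRees Sq)
      (⨆ n : ℕ, (𝔞.map (algebraMap A F.extendedRees)).colon
        ((Ideal.span {t} ^ n : Ideal F.extendedRees) : Set F.extendedRees))) := by
  have hψC : ((aeval t : A[X] →ₐ[A] F.extendedRees) : A[X] →+* F.extendedRees).comp Polynomial.C =
      algebraMap A F.extendedRees := by
    ext a
    simp
  -- the prime `𝔔 = Q ∩ A[X]`
  set 𝔔 : Ideal A[X] := Q.comap ((aeval t : A[X] →ₐ[A] F.extendedRees) : A[X] →+* F.extendedRees) with h𝔔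
  have hmem𝔔 : ∀ f : A[X], f ∈ 𝔔 ↔ aeval t f ∈ Q := fun f => by rw [h𝔔]; exact Iff.rfl
  have h𝔞𝔔 : 𝔞.map (Polynomial.C : A →+* A[X]) ≤ 𝔔 := by
    rw [Ideal.map_le_iff_le_comap, h𝔔, Ideal.comap_comap, hψC, ← Ideal.map_le_iff_le_comap]
    exact h𝔞Q
  have h𝔔p : 𝔔.comap (Polynomial.C : A →+* A[X]) = p := by
    rw [h𝔔, Ideal.comap_comap, hψC, hp]
  -- the polynomial core
  have hreg' : IsRegularLocalRing (Localization.AtPrime 𝔔 ⧸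
      (𝔞.map (Polynomial.C : A →+* A[X])).map (algebraMap A[X] (Localization.AtPrime 𝔔))) :=
    isRegularLocalRing_localization_polynomial_quotient 𝔞 𝔔 h𝔞𝔔
      (isRegularLocalRing_atPrime_quotient_of_eq 𝔞 h𝔔p.symm hreg)
  -- `S_Q` is the localization of `A[X]` at `𝔔`
  letI alg : Algebra A[X] Sq :=
    ((algebraMap F.extendedRees Sq).comp ((aeval t : A[X] →ₐ[A] F.extendedRees) : A[X] →+* F.extendedRees)).toAlgebra
  have halg : ∀ f : A[X], algebraMap A[X] Sq f = algebraMap F.extendedRees Sq (aeval t f) := fun _ => rfl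
  haveI : IsLocalization.AtPrime Sq 𝔔 := by
    refine (isLocalization_iff 𝔔.primeCompl Sq).mpr ⟨?_, ?_, ?_⟩
    · rintro ⟨y, hy⟩
      rw [halg]
      exact IsLocalization.map_units Sq (⟨aeval t y, fun h => hy ((hmem𝔔 y).mpr h)⟩ : Q.primeCompl)
    · intro z
      obtain ⟨⟨s, u⟩, hz⟩ := IsLocalization.surj Q.primeCompl z
      obtain ⟨n₁, f₁, h₁⟩ := exists_pow_mul_eq_aeval F t ht s
      obtain ⟨n₂, f₂, h₂⟩ := exists_pow_mul_eq_aeval F t ht (u : F.extendedRees)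
      have hψg : aeval t (f₂ * X ^ n₁) = (u : F.extendedRees) * t ^ (n₁ + n₂) := by
        rw [map_mul, map_pow, aeval_X, ← h₂]; ring
      have hψf : aeval t (f₁ * X ^ n₂) = s * t ^ (n₁ + n₂) := by
        rw [map_mul, map_pow, aeval_X, ← h₁]; ring
      have hg : f₂ * X ^ n₁ ∉ 𝔔 := by
        rw [hmem𝔔, hψg]
        exact Q.primeCompl.mul_mem u.2 (Q.primeCompl.pow_mem (show t ∈ Q.primeCompl from htQ) _)
      refine ⟨⟨f₁ * X ^ n₂, ⟨f₂ * X ^ n₁, hg⟩⟩, ?_⟩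
      change z * algebraMap F.extendedRees Sq (aeval t (f₂ * X ^ n₁)) =
        algebraMap F.extendedRees Sq (aeval t (f₁ * X ^ n₂))
      simp only [hψg, hψf, map_mul, ← mul_assoc, hz]
    · intro f g hfg
      rw [halg, halg] at hfg
      obtain ⟨⟨c, hc⟩, hcfg⟩ := IsLocalization.exists_of_eq (M := Q.primeCompl) hfg
      obtain ⟨n, h, hh⟩ := exists_pow_mul_eq_aeval F t ht c
      have hh𝔔 : h ∉ 𝔔 := by
        rw [hmem𝔔, ← hh]
        exact Q.primeCompl.mul_mem (Q.primeCompl.pow_mem (show t ∈ Q.primeCompl from htQ) n) hc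
      refine ⟨⟨h, hh𝔔⟩, aeval_injective F t ht ?_⟩
      change aeval t (h * f) = aeval t (h * g)
      simp only at hcfg
      rw [map_mul, map_mul, ← hh, mul_assoc, mul_assoc, hcfg]
  -- transport along `A[X]_𝔔 ≃ S_Q`
  let e₁ : Localization.AtPrime 𝔔 ≃ₐ[A[X]] Sq := IsLocalization.algEquiv 𝔔.primeCompl (Localization.AtPrime 𝔔) Sq
  have he₁ : (e₁.toRingEquiv : Localization.AtPrime 𝔔 →+* Sq).comp
      (algebraMap A[X] (Localization.AtPrime 𝔔)) = algebraMap A[X] Sq :=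
    RingHom.ext fun x => e₁.commutes x
  have hσ := map_iSup_colon_eq_map F t (𝔞.map (algebraMap A F.extendedRees)) Q htQ Sq
  have hmap : Ideal.map (algebraMap F.extendedRees Sq)
        (⨆ n : ℕ, (𝔞.map (algebraMap A F.extendedRees)).colon
          ((Ideal.span {t} ^ n : Ideal F.extendedRees) : Set F.extendedRees)) =
      Ideal.map (e₁.toRingEquiv : Localization.AtPrime 𝔔 →+* Sq)
        ((𝔞.map (Polynomial.C : A →+* A[X])).map (algebraMap A[X] (Localization.AtPrime 𝔔))) := by
    rw [hσ, Ideal.map_map, Ideal.map_map, Ideal.map_map]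
    congr 1
    rw [he₁, RingHom.algebraMap_toAlgebra, RingHom.comp_assoc, hψC]
  let e : (Localization.AtPrime 𝔔 ⧸
      (𝔞.map (Polynomial.C : A →+* A[X])).map (algebraMap A[X] (Localization.AtPrime 𝔔))) ≃+*
      Sq ⧸ Ideal.map (algebraMap F.extendedRees Sq)
        (⨆ n : ℕ, (𝔞.map (algebraMap A F.extendedRees)).colon
          ((Ideal.span {t} ^ n : Ideal F.extendedRees) : Set F.extendedRees)) :=
    Ideal.quotientEquiv _ _ e₁.toRingEquiv hmap
  exact @IsRegularLocalRing.of_ringEquiv _ _ hreg' _ _ e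

end ExtendedRees

end Summit.ResolutionOfSingularities.ResolutionOfSingularities.Theorems.ELadderOne.TrivialEnd

end
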